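import Literature.Algebra.Homology.OrderedCechSystemMap
import Mathlib.Data.Finset.Sort
import HarnessLib

/-!
# The ordered Čech complex of a system as the ALTERNATING complex: signed evaluation on arbitrary tuples — DEFINITIONS
# (The Stacks Project, Tag 01FG; Godement II §5.8; Serre FAC n° 20 «cochaînes alternées»)

Layer `Algebra/Homology` (pure algebra; cell `hodgecm-mathlib` FLOOR 0, P1 sub-line F-11, packet (iv)∕J3, brick F-C2 core-1,
F0P1b-p01 (g0)).  DEFINITIONS + their unfolding lemmas only; the two theorems with content (the FULL Čech differential formula
for the alternating extension, and «refinement along an ARBITRARY map of index sets is a cochain map») are in the sequel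
`OrderedCechSystemAlternatingDifferential` (PROOF lane).

Setting: ★ `Algebra/Homology/OrderedCechSystem(Map)` — a system `M : Finset ι ⥤ ModuleCat A` on a finite linearly ordered index
set and its ordered Čech complex `OrderedCech.sysComplex M` (ONE component `g_σ ∈ M σ` per strictly increasing tuple `σ`).  The
consumers that pull back along a NON-monotone map of index sets (the maps `p₂^♯`, `m^♯` onto a lexicographically ordered product
cover; the back face of the Alexander–Whitney cross product) must evaluate an ordered cochain on a tuple `α = (α₀, …, α_n)` that
is injective but NOT increasing; the classical answer ([StacksProject, Tag 01FG]: «`s_{i₀…i_p} = 0` if an index repeats,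
`s_{σ(i₀)…σ(i_p)} = sgn(σ) s_{i₀…i_p}`») is the ALTERNATING extension `g(α) := (-1)^{inv α} · g_{ {α₀,…,α_n} }`.

* `OrderedCech.inv α` — the number of inversions of a tuple `α : Fin m → ι` (so `(-1)^{inv α}` is the sign of the sorting permutation);
* `OrderedCech.SysCochain.altEvalAt g α t ∈ M t` — the signed value of `g` at `α`, pushed to `t ⊇ {α}` (`0` if `α` repeats an index),
  with `altEvalAt_of_injective ∕ _of_not_injective ∕ _of_strictMono ∕ _add ∕ _smul`, `map_altEvalAt`;
* `OrderedCech.imageFunctor τ : Finset ι' ⥤ Finset ι` and, for a natural family `φ_{s'} : M(τ s') → M'(s')`, the refinement of cochains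
  along an ARBITRARY `τ : ι' → ι`: `refineCochain τ φ n g` (component at `{j₀<⋯<j_n}` = `φ (g(τ j₀,…,τ j_n))`), linear: `refineLinear`.

No instance, no notation, no named fact, no `sorry`.

## References
* The Stacks Project, Tag 01FG (alternating and ordered Čech complexes; `s_{σ(i)} = sgn(σ) s_i`; refinement maps). [StacksProject]
* R. Godement, *Topologie algébrique et théorie des faisceaux*, Hermann (1958), II §5.8 (cochaînes alternées). [folklore]
* U. Görtz, T. Wedhorn, *Algebraic Geometry II* (2023), Def. 21.64, Def. 21.68 (pp. 179–181). [GortzWedhorn2023]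
-/

universe v u

open CategoryTheory

set_option backward.isDefEq.respectTransparency false -- `ModuleCat`-valued functors (as in ★ `OrderedCechSystem`)

noncomputable section

namespace Literature.Algebra.Homology

namespace OrderedCech

variable {ι : Type} [LinearOrder ι]

/-! ## §1 Inversions of a tuple -/

section Inv

variable {m : ℕ}

/-- The number of INVERSIONS of a tuple `α : Fin m → ι`: pairs of positions `p < q` with `α q < α p`.
[cite: StacksProject, Tag 01FG] -/
def inv (α : Fin m → ι) : ℕ :=
  (Finset.univ.filter fun pq : Fin m × Fin m => pq.1 < pq.2 ∧ α pq.2 < α pq.1).card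

/-- A strictly increasing tuple has no inversions. [cite: StacksProject, Tag 01FG] -/
theorem inv_eq_zero_of_strictMono {α : Fin m → ι} (h : StrictMono α) : inv α = 0 := by
  unfold inv
  rw [Finset.card_eq_zero, Finset.filter_eq_empty_iff]
  rintro ⟨p, q⟩ - ⟨hpq, hα⟩
  exact lt_asymm (h hpq) hα

end Inv

/-! ## §2 Signed evaluation of an ordered cochain on an arbitrary tuple -/

section AltEval

variable {A : Type u} [CommRing A] {M : Finset ι ⥤ ModuleCat.{v} A} {n : ℤ} {m : ℕ}

/-- **The alternating extension of an ordered cochain**: the value of `g` on the tuple `α : Fin m → ι`, pushed to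
`M t`: `(-1)^{inv α} · g_{ {α} }|_t` when `α` is injective (and `{α} ⊆ t` is an `n`-simplex), `0` when `α` repeats
an index. [cite: StacksProject, Tag 01FG] -/
def SysCochain.altEvalAt (g : SysCochain M n) (α : Fin m → ι) (t : Finset ι) : M.obj t :=
  haveI := Classical.dec (Function.Injective α)
  if Function.Injective α then (-1 : A) ^ inv α • g.ext0At (Finset.univ.image α) t else 0

/-- Unfolding on an injective tuple. [cite: StacksProject, Tag 01FG] -/
theorem SysCochain.altEvalAt_of_injective (g : SysCochain M n) {α : Fin m → ι} (hα : Function.Injective α)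
    (t : Finset ι) : g.altEvalAt α t = (-1 : A) ^ inv α • g.ext0At (Finset.univ.image α) t := by
  classical
  unfold SysCochain.altEvalAt
  rw [if_pos hα]

/-- A tuple with a repeated index evaluates to `0`. [cite: StacksProject, Tag 01FG] -/
theorem SysCochain.altEvalAt_of_not_injective (g : SysCochain M n) {α : Fin m → ι} (hα : ¬ Function.Injective α)
    (t : Finset ι) : g.altEvalAt α t = 0 := by
  classical
  unfold SysCochain.altEvalAt
  rw [if_neg hα]

/-- On a strictly increasing tuple the signed evaluation is the plain value `g.ext0At {α} t`. [cite: StacksProject, Tag 01FG] -/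
theorem SysCochain.altEvalAt_of_strictMono (g : SysCochain M n) {α : Fin m → ι} (hα : StrictMono α) (t : Finset ι) :
    g.altEvalAt α t = g.ext0At (Finset.univ.image α) t := by
  rw [g.altEvalAt_of_injective hα.injective, inv_eq_zero_of_strictMono hα, pow_zero, one_smul]

/-- Additivity in the cochain. [cite: StacksProject, Tag 01FG] -/
theorem SysCochain.altEvalAt_add (g g' : SysCochain M n) (α : Fin m → ι) (t : Finset ι) :
    (g + g').altEvalAt α t = g.altEvalAt α t + g'.altEvalAt α t := by
  classical
  by_cases hα : Function.Injective α
  · rw [altEvalAt_of_injective _ hα, altEvalAt_of_injective _ hα, altEvalAt_of_injective _ hα,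
      SysCochain.ext0At_add, smul_add]
  · rw [altEvalAt_of_not_injective _ hα, altEvalAt_of_not_injective _ hα, altEvalAt_of_not_injective _ hα,
      add_zero]

/-- Homogeneity in the cochain. [cite: StacksProject, Tag 01FG] -/
theorem SysCochain.altEvalAt_smul (c : A) (g : SysCochain M n) (α : Fin m → ι) (t : Finset ι) :
    (c • g).altEvalAt α t = c • g.altEvalAt α t := by
  classical
  by_cases hα : Function.Injective α
  · rw [altEvalAt_of_injective _ hα, altEvalAt_of_injective _ hα, SysCochain.ext0At_smul, smul_comm]
  · rw [altEvalAt_of_not_injective _ hα, altEvalAt_of_not_injective _ hα, smul_zero]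

/-- Pushing the value further along `t ⊆ t'` (restriction). [cite: StacksProject, Tag 01FG] -/
theorem SysCochain.map_altEvalAt (g : SysCochain M n) (α : Fin m → ι) (t t' : Finset ι)
    (h : Finset.univ.image α ⊆ t) (htt' : t ⊆ t') :
    (M.map (homOfLE htt')).hom (g.altEvalAt α t) = g.altEvalAt α t' := by
  classical
  by_cases hα : Function.Injective α
  · rw [altEvalAt_of_injective _ hα, altEvalAt_of_injective _ hα, map_smul, SysCochain.map_ext0At g _ _ _ h htt']
  · rw [altEvalAt_of_not_injective _ hα, altEvalAt_of_not_injective _ hα, map_zero]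

end AltEval

/-! ## §3 Refinement of cochains along an arbitrary map of index sets -/

section Refine

variable {ι' : Type} [LinearOrder ι'] {A : Type u} [CommRing A]

/-- The image functor `s' ↦ τ(s')` on finite subsets along a map of index sets `τ : ι' → ι` (monotone for `⊆`) — the
index-level shape of «the cover `𝓦'` refines `𝓤` along `τ`». [cite: StacksProject, Tag 01FG] -/
def imageFunctor (τ : ι' → ι) : Finset ι' ⥤ Finset ι :=
  Monotone.functor (f := fun s' : Finset ι' => s'.image τ) fun _ _ h => Finset.image_subset_image h

omit [LinearOrder ι'] in
/-- `imageFunctor τ` on objects. [cite: StacksProject, Tag 01FG] -/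
@[simp] theorem imageFunctor_obj (τ : ι' → ι) (s' : Finset ι') :
    (imageFunctor τ).obj s' = s'.image τ := rfl

variable {M : Finset ι ⥤ ModuleCat.{v} A} {M' : Finset ι' ⥤ ModuleCat.{v} A} (τ : ι' → ι)
  (φ : imageFunctor τ ⋙ M ⟶ M')


/-- **Refinement of ordered cochains along an arbitrary map of index sets** `τ : ι' → ι`, for systems `M` on `ι`,
`M'` on `ι'` and a natural family `φ_{s'} : M(τ s') → M'(s')` («`W'_{s'} ⊆ U_{τ s'}`» and restriction): the
component at the simplex `s' = {j₀ < ⋯ < j_n}` is `φ_{s'}` of the SIGNED value `g(τ j₀, …, τ j_n)` (alternating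
extension; `0` if `τ` is not injective on `s'`). [cite: StacksProject, Tag 01FG] -/
def refineCochain (n : ℤ) (g : SysCochain M n) : SysCochain M' n := fun σ' =>
  (φ.app σ'.1).hom (g.altEvalAt (τ ∘ ⇑(σ'.1.orderEmbOfFin rfl)) (σ'.1.image τ))

/-- Components of the refinement. [cite: StacksProject, Tag 01FG] -/
theorem refineCochain_apply (n : ℤ) (g : SysCochain M n) (σ' : Simplex ι' n) :
    refineCochain τ φ n g σ' =
      (φ.app σ'.1).hom (g.altEvalAt (τ ∘ ⇑(σ'.1.orderEmbOfFin rfl)) (σ'.1.image τ)) := rfl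

/-- The refinement as a linear map of cochains. [cite: StacksProject, Tag 01FG] -/
def refineLinear (n : ℤ) : SysCochain M n →ₗ[A] SysCochain M' n where
  toFun := refineCochain τ φ n
  map_add' g g' := by
    funext σ'
    change (φ.app σ'.1).hom _ = (φ.app σ'.1).hom _ + (φ.app σ'.1).hom _
    rw [SysCochain.altEvalAt_add, map_add]
  map_smul' c g := by
    funext σ'
    change (φ.app σ'.1).hom _ = c • (φ.app σ'.1).hom _
    rw [SysCochain.altEvalAt_smul, map_smul]

end Refine

end OrderedCech

end Literature.Algebra.Homology

end
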